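import Literature.MathematicalPhysics.QuantumLattice.HubbardKuboKishiFSum
import Literature.MathematicalPhysics.QuantumLattice.HubbardKuboKishiGaussianDomination
import HarnessLib

/-!
# Thermal Mott ceilings on the charge channel of the half-filled `L × L` Hubbard torus — unconditional

Bounds for a MODEL CLASS (the repulsive Hubbard model on the even `L × L` torus at half filling,
`t = 1`, `μ = U/2`, grand-canonical Gibbs state at inverse temperature `β`); no materials claim.
HONEST FRAMING: ladder R1–R4 with certified numbers; no claim on H/H₀.

Kubo–Kishi's Theorem 2 [KuboKishi1990, eq. (5)]: for `U > 0` at half filling on a bipartite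
lattice the charge Duhamel (Kubo) susceptibility obeys `β (D_a, D_a)_β ≤ Σ_x a_x² / U` for EVERY
real profile `a`, `D_a = Σ_x a_x (n_x - 1)` — i.e. `χ_c(q) ≤ 1/U` for all momenta `q` and all
temperatures. Their proof's one analytic input, the Gaussian-domination inequality
`Ξ({h}) ≤ Ξ`, is the tree theorem `kuboKishi_charge_gaussianDomination_holds`
(`HubbardKuboKishiGaussianDomination.lean`, Dyson–Lieb–Simon Lemma 4.1 transported by Shiba's
map), so the cell nodes below are UNCONDITIONAL theorems:

* `ThermalMottChargeSusceptibilityCeilingProfile` — KK (5) for every real profile `a` (all `q`):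
  `Re (D_a, D_a)_β ≤ Σ a² /U /β`.
* `ThermalMottNumberVarianceCeiling` — the profile `a ≡ 1` (`D_1 = N - L²` commutes with `H`, no
  gradient term): `⟨(N - L²)²⟩_β ≤ L² /U /β`, i.e. the isothermal compressibility of the half-filled
  model obeys `∂n/∂μ = β ⟨(N - L²)²⟩_β / L² ≤ 1/U` at EVERY temperature (Kubo–Kishi's Remark 3,
  quantitative; the tree's `kuboKishi_totalNumber_sq_le`). For comparison the free-fermion value
  at half filling diverges like `log(t/T)` (van Hove), so the ceiling is informative for all
  `T ≲ t` once `U ≳ 4t`.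
* `ThermalMottNumberVarianceCeilingU20` — the strong-coupling point of the ladder, `U = 20`:
  `⟨(N - L²)²⟩_β / L² ≤ T/20`, `∂n/∂μ ≤ 0.05/t`.

All three `_holds` are one-line specialisations of Literature theorems; 0 sorry.
-/

noncomputable section

open Matrix Finset Real
open Literature.MathematicalPhysics.QuantumLattice
open Literature.Probability.LatticeModels
open scoped ComplexOrder ComplexConjugate

namespace Summit.HubbardSuperconductivity.HubbardLadder.Bounds

section Torus

/-- **KK (5), all momenta, unconditional.** On the even `L × L` torus at half filling (`t = 1`,
`μ = U/2`, `U > 0`, `β > 0`), for every real profile `a`: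
`Re (D_a, D_a)_β ≤ (Σ_x a_x²)/U/β`, `D_a = Σ_x a_x (n_x - 1)` (`chargeDensityField a`).
[cite: KuboKishi1990, Theorem 2, eq. (5)] -/
@[conjecture] def ThermalMottChargeSusceptibilityCeilingProfile : Prop :=
  ∀ (L : ℕ) [NeZero L], Even L → ∀ (U β : ℝ), 0 < U → 0 < β → ∀ a : FermionTorus 2 L → ℝ,
    (duhamel β (hamiltonianWith (fermionTorusGraph 2 L) 1 U (U / 2)) (chargeDensityField a)
        (chargeDensityField a)).re ≤ (∑ x, a x ^ 2) / U / β

/-- Proof of `ThermalMottChargeSusceptibilityCeilingProfile` (KK (5) on the even torus, from the Literature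
theorem `kuboKishi_charge_duhamel_le_torus` and `kuboKishi_charge_gaussianDomination_holds`).
[cite: KuboKishi1990, Theorem 2 eq. (5)] -/
theorem thermalMottChargeSusceptibilityCeilingProfile_holds :
    ThermalMottChargeSusceptibilityCeilingProfile := by
  intro L _ hL U β hU hβ a
  have h := kuboKishi_charge_duhamel_le_torus 2 L kuboKishi_charge_gaussianDomination_holds hL
    (t := 1) hU hβ a
  have hH : hubbardTorusWith 2 L 1 U (U / 2) = hamiltonianWith (fermionTorusGraph 2 L) 1 U (U / 2) :=
    rfl
  rw [hH] at h
  exact h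

/-- **Number variance / compressibility ceiling, unconditional.** On the even `L × L` torus at half
filling (`t = 1`, `μ = U/2`, `U > 0`, `β > 0`): `⟨(N - L²)²⟩_β ≤ L²/U/β`, i.e.
`∂n/∂μ = β⟨(N - L²)²⟩_β/L² ≤ 1/U` at every temperature.
[cite: KuboKishi1990, Theorem 2 and Remark 3] -/
@[conjecture] def ThermalMottNumberVarianceCeiling : Prop :=
  ∀ (L : ℕ) [NeZero L], Even L → ∀ (U β : ℝ), 0 < U → 0 < β →
    (gibbsState β (hamiltonianWith (fermionTorusGraph 2 L) 1 U (U / 2))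
        (chargeDensityField (fun _ : FermionTorus 2 L => (1 : ℝ)) *
          chargeDensityField fun _ : FermionTorus 2 L => (1 : ℝ))).re ≤ (L : ℝ) ^ 2 / U / β

/-- Proof of `ThermalMottNumberVarianceCeiling` (from the Literature theorem `kuboKishi_totalNumber_sq_le`
and `kuboKishi_charge_gaussianDomination_holds`). [cite: KuboKishi1990, Theorem 2 and Remark 3] -/
theorem thermalMottNumberVarianceCeiling_holds : ThermalMottNumberVarianceCeiling := by
  intro L _ hL U β hU hβ
  have hcard : (Fintype.card (FermionTorus 2 L) : ℝ) = (L : ℝ) ^ 2 := by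
    simp [FermionTorus, Fintype.card_lex]
  have h := kuboKishi_totalNumber_sq_le (fermionTorusGraph 2 L)
    kuboKishi_charge_gaussianDomination_holds torusStagger
    (fun _ _ h => torusStagger_eq_neg_of_adj_holds hL h) (t := 1) hU hβ
  rw [hcard] at h
  convert h using 6

/-- **The `U = 20` point of the ladder**: `⟨(N - L²)²⟩_β ≤ L²/20/β`, i.e. `∂n/∂μ ≤ 0.05/t` at every
temperature. [cite: KuboKishi1990, Theorem 2 and Remark 3] -/
@[conjecture] def ThermalMottNumberVarianceCeilingU20 : Prop :=
  ∀ (L : ℕ) [NeZero L], Even L → ∀ (β : ℝ), 0 < β →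
    (gibbsState β (hamiltonianWith (fermionTorusGraph 2 L) 1 20 (20 / 2))
        (chargeDensityField (fun _ : FermionTorus 2 L => (1 : ℝ)) *
          chargeDensityField fun _ : FermionTorus 2 L => (1 : ℝ))).re ≤ (L : ℝ) ^ 2 / 20 / β

/-- Proof of `ThermalMottNumberVarianceCeilingU20` (the variance ceiling at `U = 20`).
[cite: KuboKishi1990, Theorem 2 and Remark 3] -/
theorem thermalMottNumberVarianceCeilingU20_holds : ThermalMottNumberVarianceCeilingU20 := by
  intro L _ hL β hβ
  exact thermalMottNumberVarianceCeiling_holds L hL 20 β (by norm_num) hβ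

end Torus

end Summit.HubbardSuperconductivity.HubbardLadder.Bounds

end
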